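import Summits.QuantumFields.YangMills.Theorems.UnitScaleTiltProp8FlatPortHRows12
import Summits.QuantumFields.YangMills.Theorems.UnitScaleTiltProp8FlatPortDistanceL0
import Summits.QuantumFields.YangMills.Theorems.BalabanUVNodesK0FlatCubeOpsTextP
import Literature.MathematicalPhysics.QuantumFieldTheory.Balaban1983to89.B6GradLegKLevelV1L0
import HarnessLib

/-!
# K0⁷ `stub_prop8StepCoP13` (stmt-QuantumFields-20541), sub-target S5, S5 ROAD item (b) — the d-generic port, file P4 (twin of `UnitScaleTiltProp8FlatPortHRows12L0`):
# **THE KERNEL ROWS (k1), (k2) OF `K0FlatCubeOpsTextP.HKernelRows` FOR THE CANONICAL `flatH` ON THE TORI `PV d ℓ m K` ARE lit-balaban's [Balaban1984PropagatorsII]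
# COROLLARY 2.8 (2.151)₁,₂ (`B6Cor28EntriesKLevelV1L0.cor28_kLevel_H_DH` SHAPE, any `d`) READ THROUGH THE LEVEL-0 CHART** (units `c′ = L^{K−n}`, any positive band weights,
# indicator data `e_c`, forward difference `DV ν c′`, block length `L^{j(b)}`, distance `dBI := d_T + 3 ≥ distBI`)

Cell `pub-ymgap`, width seat `pub-ymgap-k0-s1-w3` gen 2 (D-0149; START LIST v7 §k0-s1 «S5 ROAD LOCATED … UNOWNED ×3», item (b) = the d-GENERIC PORT re-run of the
ym3-torus bridge `UnitScaleTiltProp8FlatPort*L0`, plan g80 WORDS-1b l.25728).  `--kind proof --supports stmt-QuantumFields-20541 --as helper`; count-neutral; def-free.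
METHOD: the UST file is re-typed with the carrier `PV 2 ℓ m K ↦ PV d ℓ m K hd hL` (dimension `2 + 1 ↦ d + 1`, directions `Fin (d + 1)`), the P2 letters read in their
carrier-generic form `K0FlatCubeOpsTextP.*` at `(P, k) := (PV d ℓ m K hd hL, K − n)` (the `T3Family` binder and `hm : 1 ≤ m` disappear); proofs VERBATIM after the
substitution; every `D`-free ∕ carrier-free lemma of the UST files is consumed BY NAME (imports), nothing of theirs restated.  lit-balaban's k-level
[Balaban1984PropagatorsII] rows (`…KLevelV1L0`, generic in `d`) are the content, consumed by name.

WHAT IS PROVED (sorry-free; axioms standard; no definition): `flatH_apply_eq` (the canonical `flatH (PV d ℓ m K) (K − n) (domT hN D hk) e b` IS the port's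
`(GE ∘ QsE ∘ EE)_{w♯,c′} (single c 1) b`), `levWeight_one_eq`, `len_blkV1_eq`, **`hRows12_of_cor28Shape`** (the two displayed conclusions of `cor28_kLevel_H_DH` ⇒ rows (k1), (k2)
of `HKernelRows … (d_T + 3) w (flatH …) (C·e^{3δ}) δ`).
THE PRINT.  [Balaban1984PropagatorsII] Cor. 2.8 p. 249: *«|H(b,c)|, |(∇H)(b,c)| ≦ O(1)[1, (Lʲη)⁻¹](L^{j′}η)^{−d}e^{−δ₅d(y,c₋)}»*; [Balaban1985Variational] (161)₁ p. 303.
HONEST FRAMING: count-neutral helper; nothing of [Balaban1985Variational] Sect. F itself is asserted; K0⁷ OPEN; N07 NOT discharged (5∕27 unmoved); one finite 𝕋⁴ programme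
at fixed ε — R4 closes the conditional finite-𝕋⁴ rung `BalabanLadder.UV` only; the YM mass gap (Clay) is NOT proved by any of this; nothing continuum ∕ ℝ⁴ ∕ OS.

References: T. Bałaban, CMP **96** (1984) 223–250 [Balaban1984PropagatorsII] (2.35) p.228, Cor. 2.8 (2.150)–(2.151) p.249; CMP **102** (1985) 277–309 [Balaban1985Variational]
(45)–(46) p.285, (157) p.302, (161) p.303.
-/

set_option autoImplicit false

noncomputable section

open scoped BigOperators

namespace Summit.QuantumFields.YangMills.Theorems.K0FlatPortHRows12P

open FlatPortHRows12 (indicator_eq_single toLp_indicator_eq_single cf_ne_zero)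

open Literature.MathematicalPhysics.QuantumFieldTheory.Balaban1983to89
open Literature.MathematicalPhysics.QuantumFieldTheory.BalabanImbrieJaffe1984to88.BIJ85AxialPropagator411 (BondSpace)
open B5Eq118OneStroke (iterBlockOf)
open B6MultiLevelBoxOperator (N0)
open B6MultiLevelTorusOperatorL0 (TDomains)
open B6Geom246MultiLevelBoxL0 (bset)
open B6Geom246MultiLevelTorusL0 (geomT bondT)
open B6GlobalChartV1 (PV toBox)
open B6GlobalChartV1L0 (blkV1 domT)
open B6Ineq2142KLevelV1L0 (β)
open B6Ineq2133TwoScaleV1 (onFun onFun_apply)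
open B6GradLegKLevelV1 (DV DV_apply)
open B6SectADomainsV1 (Domains)
open B6SectAOperatorsV1 (BondIdx BondIdxSpace QsE)
open B6SectAVectorModelV1 (GE EE)
open B6SectA (hOp)
open B11Eq115Space (levOf)
open FlatCubeOpsText (distBI)
open Summit.QuantumFields.YangMills.Theorems.K0FlatCubeOpsTextP (IsLevWeight)
open Summit.QuantumFields.YangMills.Theorems.K0FlatCubeOpsTextP (flatH)
open FlatPortDistanceL0 (levOf_domT blkV1_level distBI_domT_le)

/-! ## §1 Dictionary: indicators, the canonical `H`, the level weight and the block length -/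

section Carrier

variable (d ℓ : ℕ) (hd : 1 ≤ d + 1) (hL : Odd (ℓ + 1) ∧ 1 < ℓ + 1) (m : ℕ) (n K : ℕ)
variable {Mh R : ℕ} {P' : Fin (d + 1) → ℕ}
variable (hN : ∀ μ, N0 ℓ Mh (K - n) P' μ = (PV d ℓ m K hd hL).sitesPerDir 0) (D : TDomains d ℓ Mh (K - n) P' R) (hk : K - n ≤ m + K)

/-- **THE CANONICAL `flatH` IS THE PORT's `H = GE ∘ QsE ∘ EE` WITH ANY POSITIVE WEIGHTS**, read against the coordinate vector (`hOp_eq_hOp`: `H` does not depend on the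
auxiliary weights; the units of `flatH` are `c′ = L^{K−n}`). [cite: Balaban1984PropagatorsII, (2.35) p.228; Balaban1985Variational, (45) p.285, (157) p.302] -/
theorem flatH_apply_eq {w' : BondIdx (B6GlobalChartV1L0.domT (hd := hd) hN D hk) → ℝ} (hw' : ∀ i, 0 < w' i)
    {c : BondIdx (domT (hd := hd) hN D hk)} {e : BondIdx (domT (hd := hd) hN D hk) → ℝ} (he : e c = 1) (he' : ∀ c', c' ≠ c → e c' = 0)
    (b : PBond (PV d ℓ m K hd hL) 0) :
    flatH (PV d ℓ m K hd hL) (K - n) (domT (hd := hd) hN D hk) e b =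
      (GE (domT (hd := hd) hN D hk) (cf_ne_zero ℓ n K) hw' ∘ₗ QsE (domT (hd := hd) hN D hk) ∘ₗ
        EE (domT (hd := hd) hN D hk) (cf_ne_zero ℓ n K) hw') (EuclideanSpace.single c (1 : ℝ)) b := by
  have h0 : flatH (PV d ℓ m K hd hL) (K - n) (domT (hd := hd) hN D hk) e b =
      hOp (GE (domT (hd := hd) hN D hk) (cf_ne_zero ℓ n K) (fun _ => one_pos) (w := fun _ => (1 : ℝ)))
        (QsE (domT (hd := hd) hN D hk)) (EE (domT (hd := hd) hN D hk) (cf_ne_zero ℓ n K) (fun _ => one_pos) (w := fun _ => (1 : ℝ)))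
        (WithLp.toLp 2 e) b := rfl
  rw [h0, FlatCubeOperators.hOp_eq_hOp (domT (hd := hd) hN D hk) (cf_ne_zero ℓ n K) (fun _ => one_pos) hw' (WithLp.toLp 2 e),
    toLp_indicator_eq_single he he']
  rfl

/-- **THE LEVEL WEIGHT** of the P2 text at the charted family: `w 1 b = L^{j(b)}·L^{−(K−n)}` with `j(b) = D.lev (toBox b₋)`. [cite: Balaban1985Variational, p.286, (115) p.294] -/
theorem levWeight_one_eq {w : ℕ → PBond (PV d ℓ m K hd hL) 0 → ℝ}
    (hw : IsLevWeight (PV d ℓ m K hd hL) (K - n) (B6GlobalChartV1L0.domT (hd := hd) hN D hk) w) (b : PBond (PV d ℓ m K hd hL) 0) :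
    w 1 b = (((ℓ + 1 : ℕ) : ℝ)) ^ D.lev (toBox hN b.src : Fin (d + 1) → ℤ) * ((((ℓ + 1 : ℕ) : ℝ))⁻¹) ^ (K - n) := by
  rw [hw 1 b, pow_one]
  have hlev := levOf_domT (hd := hd) hN D hk b.src
  show ((((PV d ℓ m K hd hL).L : ℕ) : ℝ)) ^ levOf (fun j => {x : Site (PV d ℓ m K hd hL) 0 | (domT (hd := hd) hN D hk).InOm j x}) (K - n) b.src *
      (((((PV d ℓ m K hd hL).L : ℕ) : ℝ))⁻¹) ^ (K - n) = _
  rw [hlev]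

/-- the block length of the lineage at the block of a fine bond: `len(y(b)) = L^{j(b)}` (`η = 1` in `geomT`). [cite: Balaban1984PropagatorsII, (2.46) p.231, dictionary] -/
theorem len_blkV1_eq (b : PBond (PV d ℓ m K hd hL) 0) :
    (geomT D).len (B6GlobalChartV1L0.blkV1 hN D b) = (((ℓ + 1 : ℕ) : ℝ)) ^ D.lev (toBox hN b.src : Fin (d + 1) → ℤ) := by
  show ((ℓ : ℝ) + 1) ^ (blkV1 hN D b).1.1 * 1 = _
  rw [mul_one, blkV1_level]
  push_cast
  ring

end Carrier

/-! ## §2 Rows (k1), (k2) from the Corollary 2.8 shape -/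

section Rows

variable (d ℓ : ℕ) (hd : 1 ≤ d + 1) (hL : Odd (ℓ + 1) ∧ 1 < ℓ + 1) (m : ℕ) (n K : ℕ)
variable {Mh R : ℕ} {P' : Fin (d + 1) → ℕ}
variable (hN : ∀ μ, N0 ℓ Mh (K - n) P' μ = (PV d ℓ m K hd hL).sitesPerDir 0) (D : TDomains d ℓ Mh (K - n) P' R) (hk : K - n ≤ m + K)

/-- **ROWS (k1), (k2) OF `HKernelRows` FROM THE COROLLARY 2.8 SHAPE.**  Hypotheses: the two conclusions of `B6Cor28EntriesKLevelV1L0.cor28_kLevel_H_DH` for the family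
`domT hN D hk` at units `c′ = L^{K−n}`, some positive weights `w♯`, constants `C`, `δ` (verbatim shapes `h₁`, `h₂`); `M_h ≥ 1`, `P′ ≥ 1`.  Conclusion: for every
P2 weight family `w`, index bond `c`, indicator `e_c`, fine bond `b`, with `d := d_T(y(b), β c)`:
`|(flatH e_c)(b)| ≤ Ce^{3δ}·e^{−δ(d + 3)}` and `w₁(b)·L^{K−n}·|(flatH e_c)(b + e_ν) − (flatH e_c)(b)| ≤ Ce^{3δ}·e^{−δ(d + 3)}` — i.e. (k1), (k2) over the distance `d_T + 3`
(which dominates `distBI`, `FlatPortDistanceL0.distBI_domT_le`). [cite: Balaban1984PropagatorsII, Cor. 2.8 (2.150)-(2.151) p.249; Balaban1985Variational, (161) p.303] -/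
theorem hRows12_of_cor28Shape {ws : BondIdx (B6GlobalChartV1L0.domT (hd := hd) hN D hk) → ℝ} (hws : ∀ i, 0 < ws i) {C δ : ℝ}
    (h₁ : ∀ (c : BondIdx (domT (hd := hd) hN D hk)) (f : PBond (PV d ℓ m K hd hL) 0),
      |(GE (domT (hd := hd) hN D hk) (cf_ne_zero ℓ n K) hws ∘ₗ QsE (domT (hd := hd) hN D hk) ∘ₗ
          EE (domT (hd := hd) hN D hk) (cf_ne_zero ℓ n K) hws) (EuclideanSpace.single c (1 : ℝ)) f| ≤
        C * Real.exp (-(δ * (geomT D).dist (blkV1 hN D f) (β hN D hk c))))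
    (h₂ : ∀ (ν : Fin (d + 1)) (c : BondIdx (domT (hd := hd) hN D hk)) (f : PBond (PV d ℓ m K hd hL) 0),
      |(DV ν ((((ℓ + 1 : ℕ) : ℝ)) ^ (K - n)) ∘ₗ onFun (GE (domT (hd := hd) hN D hk) (cf_ne_zero ℓ n K) hws ∘ₗ QsE (domT (hd := hd) hN D hk) ∘ₗ
          EE (domT (hd := hd) hN D hk) (cf_ne_zero ℓ n K) hws)) (Pi.single c 1) f| ≤
        C * ((geomT D).len (blkV1 hN D f) * |(((ℓ + 1 : ℕ) : ℝ)) ^ (K - n)|⁻¹)⁻¹ * Real.exp (-(δ * (geomT D).dist (blkV1 hN D f) (β hN D hk c))))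
    (w : ℕ → PBond (PV d ℓ m K hd hL) 0 → ℝ) (hw : IsLevWeight (PV d ℓ m K hd hL) (K - n) (domT (hd := hd) hN D hk) w)
    (c : BondIdx (domT (hd := hd) hN D hk)) (e : BondIdx (domT (hd := hd) hN D hk) → ℝ) (he : e c = 1) (he' : ∀ c', c' ≠ c → e c' = 0)
    (b : PBond (PV d ℓ m K hd hL) 0) :
    |flatH (PV d ℓ m K hd hL) (K - n) (domT (hd := hd) hN D hk) e b| ≤
        C * Real.exp (3 * δ) * Real.exp (-(δ * (((bondT D).dist (blkV1 hN D b) (β hN D hk c) : ℝ) + 3))) ∧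
      ∀ ν : Fin (d + 1), w 1 b * (((ℓ + 1 : ℕ) : ℝ)) ^ (K - n) *
          |flatH (PV d ℓ m K hd hL) (K - n) (domT (hd := hd) hN D hk) e ⟨b.src.shift ν, b.dir⟩ -
            flatH (PV d ℓ m K hd hL) (K - n) (domT (hd := hd) hN D hk) e b| ≤
        C * Real.exp (3 * δ) * Real.exp (-(δ * (((bondT D).dist (blkV1 hN D b) (β hN D hk c) : ℝ) + 3))) := by
  set cf : ℝ := (((ℓ + 1 : ℕ) : ℝ)) ^ (K - n) with hcf
  set dT : ℝ := ((bondT D).dist (blkV1 hN D b) (β hN D hk c) : ℝ) with hdT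
  have hL0 : (0 : ℝ) < ((ℓ + 1 : ℕ) : ℝ) := by exact_mod_cast Nat.succ_pos ℓ
  have hcf0 : 0 < cf := pow_pos hL0 _
  -- the exponential bookkeeping: `e^{−δd} = e^{3δ}·e^{−δ(d+3)}`
  have hexp : Real.exp (-(δ * dT)) = Real.exp (3 * δ) * Real.exp (-(δ * (dT + 3))) := by
    rw [← Real.exp_add]; congr 1; ring
  have hdist : (geomT D).dist (blkV1 hN D b) (β hN D hk c) = dT := rfl
  refine ⟨?_, fun ν => ?_⟩
  · -- (k1)
    rw [flatH_apply_eq d ℓ hd hL m n K hN D hk hws he he' b]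
    have h := h₁ c b
    rw [hdist, hexp, ← mul_assoc] at h
    exact h
  · -- (k2): the port's `DV ν c′ (onFun H) (Pi.single c 1) b = c′·((flatH e)(b + e_ν) − (flatH e)(b))`
    have hH : ∀ b' : PBond (PV d ℓ m K hd hL) 0,
        onFun (GE (domT (hd := hd) hN D hk) (cf_ne_zero ℓ n K) hws ∘ₗ QsE (domT (hd := hd) hN D hk) ∘ₗ
            EE (domT (hd := hd) hN D hk) (cf_ne_zero ℓ n K) hws) (Pi.single c 1) b' =
          flatH (PV d ℓ m K hd hL) (K - n) (domT (hd := hd) hN D hk) e b' := by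
      intro b'
      rw [onFun_apply, ← indicator_eq_single he he', flatH_apply_eq d ℓ hd hL m n K hN D hk hws he he' b', toLp_indicator_eq_single he he']
    have h := h₂ ν c b
    rw [LinearMap.comp_apply, DV_apply, hH, hH, hdist, hexp, len_blkV1_eq d ℓ hd hL m n K hN D] at h
    rw [levWeight_one_eq d ℓ hd hL m n K hN D hk hw b]
    -- units: `w₁·c′ = L^{j(b)}`, and the port's prefactor is `c′·L^{−j(b)}`
    set Lj : ℝ := (((ℓ + 1 : ℕ) : ℝ)) ^ D.lev (toBox hN b.src : Fin (d + 1) → ℤ) with hLj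
    have hLj0 : 0 < Lj := pow_pos hL0 _
    have hw1 : Lj * ((((ℓ + 1 : ℕ) : ℝ))⁻¹) ^ (K - n) * cf = Lj := by
      rw [hcf, inv_pow]; field_simp
    rw [hw1]
    have habs : |cf| = cf := abs_of_pos hcf0
    rw [habs] at h
    -- `h : |c′·diff| ≤ C·(Lj·c′⁻¹)⁻¹·(e^{3δ}e^{−δ(d+3)})`
    rw [abs_mul, habs] at h
    have hpre : (Lj * cf⁻¹)⁻¹ = cf * Lj⁻¹ := by rw [mul_inv, inv_inv, mul_comm]
    rw [hpre] at h
    -- divide by `c′` and multiply by `Lj`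
    have h' : cf * (Lj * |flatH (PV d ℓ m K hd hL) (K - n) (domT (hd := hd) hN D hk) e ⟨b.src.shift ν, b.dir⟩ -
          flatH (PV d ℓ m K hd hL) (K - n) (domT (hd := hd) hN D hk) e b|) ≤
        cf * (C * Real.exp (3 * δ) * Real.exp (-(δ * (dT + 3)))) := by
      calc cf * (Lj * |flatH (PV d ℓ m K hd hL) (K - n) (domT (hd := hd) hN D hk) e ⟨b.src.shift ν, b.dir⟩ -
            flatH (PV d ℓ m K hd hL) (K - n) (domT (hd := hd) hN D hk) e b|)
          = Lj * (cf * |flatH (PV d ℓ m K hd hL) (K - n) (domT (hd := hd) hN D hk) e ⟨b.src.shift ν, b.dir⟩ -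
            flatH (PV d ℓ m K hd hL) (K - n) (domT (hd := hd) hN D hk) e b|) := by ring
        _ ≤ Lj * (C * (cf * Lj⁻¹) * (Real.exp (3 * δ) * Real.exp (-(δ * (dT + 3))))) := mul_le_mul_of_nonneg_left h hLj0.le
        _ = cf * (C * Real.exp (3 * δ) * Real.exp (-(δ * (dT + 3)))) := by field_simp
    exact le_of_mul_le_mul_left h' hcf0

end Rows

end Summit.QuantumFields.YangMills.Theorems.K0FlatPortHRows12P

end
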